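import Summits.BirchSwinnertonDyer.BirchSwinnertonDyer.Theorems.SchneiderFreeAdditiveX3PotMultBranchIMCTargetCurrency
import HarnessLib

/-!
# Route `SchneiderFreeAdditiveX3` (rung K1 door), crux `GordTwoBranchIMC` (item stmt-BirchSwinnertonDyer-19177):
# modulo Kolyvagin and the control crux, the crux IS the (G-ord, `e = 2`) half of the target `StepLManin`,
# and the two branch cruxes together ARE the target

Cell `bsd-schneider-ideate`, seat `bsd-schneider-door-c3` (prover, generation 3). HONEST FRAMING:
arithmetic bookkeeping on the route's own sockets; NOTHING is asserted about elliptic curves; the cruxes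
`GordTwoBranchIMC` (Keller–Yin arXiv:2410.23241 Thm. 3.5.1 ∘ value at 𝟙, PREPRINT + unwritten),
`PotMultBranchIMC` and the control crux `AnticycControlAdditive(K)` stay OPEN; BSD is not advanced by
this file; it is `--supports` material for item 19177 — the (G-ord, `e = 2`) twin of door-c2's
`SchneiderFreeAdditiveX3PotMultBranchIMCTargetCurrency.lean` (p421895) and the door-level statement the
tribunal's «C versus S» question asks for, in kernel form.

* `additiveStepLInputManinAt_of_kolyvagin_of_gordTwo_of_control`: Kolyvagin + `GordTwoBranchIMC` +
  `AnticycControlAdditive` ⟹ the target's socket `AdditiveStepLInputManinAt W p` on every pair of the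
  potentially good ordinary `e = 2` reducible cell (door-c2 g0's `indexLowerBoundLeAt_of_frames_of_shaFinite`
  at the frames of that cell).
* `gordTwoBranchIMC_of_kolyvagin_of_control_of_stepL_subGordTwo`: the CONVERSE — Kolyvagin's finiteness
  of `Ш(E/K)` turns the target's currency (`shaOrder`, `∏_ℓ c_ℓ`) into the frames' currency
  (`#Ш[p^∞]`, `∏_{w∣N⁺} c_w`; door-c2 g2's `index_le_primary_of_indexLowerBoundLeAt_of_shaFinite`), and the
  control crux turns the frame-free inequality into the socket at every frame
  (`additiveIMCLowerBDPOnTreeLeAt_of_control_of_index_le`).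
* `gordTwoBranchIMC_iff_stepL_subGordTwo_of_kolyvagin_of_control`: modulo Kolyvagin and crux r4,
  `GordTwoBranchIMC ↔ ∀ pairs on (G-ord, e = 2), AdditiveStepLInputManinAt W p`.
* **`stepLManin_iff_potMult_and_gordTwo_of_kolyvagin_of_control`**: modulo Kolyvagin and crux r4, the
  TARGET `StepLManin` ↔ `PotMultBranchIMC ∧ GordTwoBranchIMC` (`SubSemistableTwist = SubM ∪ SubGordTwo`).
  The decomposition of the door into the two branch cruxes neither loses nor gains strength.
* rev-6 currency (`AnticycControlAdditiveK`, item 19295, = Kolyvagin → crux r4): the same two `iff`s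
  with `h4 : AnticycControlAdditiveK` (`…_of_controlK`).

References: Jetchev–Skinner–Wan, Camb. J. Math. 5 (2017) §7.3.1 (eq:tamK), §7.4.1 (eq:shalowerK-1)
(arXiv:1512.06894 p. 30); Gross 1991 Thm. 1.3 (Kolyvagin).
-/

noncomputable section

open scoped Classical

open WeierstrassCurve NumberField IsDedekindDomain Field
  Literature.NumberTheory.EllipticCurves
  Literature.NumberTheory.EllipticCurves.ModularForms
  Literature.NumberTheory.EllipticCurves.GreenbergSelmer
  Literature.NumberTheory.EllipticCurves.Rank1Residual
  Literature.NumberTheory.EllipticCurves.Rank1Residual.Typed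
  Summit.BirchSwinnertonDyer.Rank1Residual
  Summit.BirchSwinnertonDyer.Rank1Residual.X11b
  Summit.BirchSwinnertonDyer.Rank1Residual.X11b.AcSelmer
  Summit.BirchSwinnertonDyer.Rank1Residual.X11b.Halves
  Summit.BirchSwinnertonDyer.BirchSwinnertonDyer.Theses.SchneiderFreeAdditiveX3

-- D-0017 layout: summit = sub-problem, so `Summit.BirchSwinnertonDyer.BirchSwinnertonDyer.…` is the
-- mandated namespace (same option as the route's sockets files).
set_option linter.dupNamespace false
set_option autoImplicit false

namespace Summit.BirchSwinnertonDyer.BirchSwinnertonDyer.Theorems.SchneiderFree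

/-! ### The (G-ord, `e = 2`) half of the target from the crux, and back -/

/-- **The (G-ord, `e = 2`) half alone (this seat's crux)**: Kolyvagin + `GordTwoBranchIMC` +
`AnticycControlAdditive` give STEP L (Manin-robust) on the potentially good ordinary `e = 2` reducible
cell, i.e. `StepLManin` restricted to `SubGordTwo`. The twin of door-c2's
`additiveStepLInputManinAt_of_kolyvagin_of_potMult_of_control`. CONDITIONAL on the three hypotheses
(the first printed, the other two open). [cite: JetchevSkinnerWan2017, §7.4.1 (arXiv:1512.06894 p. 30)] [cite: Gross1991, Thm. 1.3] -/
theorem additiveStepLInputManinAt_of_kolyvagin_of_gordTwo_of_control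
    (hKo : ∀ (N : ℕ) [NeZero N] (W : WeierstrassCurve ℚ) (K : Type) [Field K] [NumberField K],
      Literature.NumberTheory.EllipticCurves.kolyvagin N W K)
    (h3 : Theses.SchneiderFreeAdditiveX3.GordTwoBranchIMC)
    (h4 : Theses.SchneiderFreeAdditiveX3.AnticycControlAdditive) :
    ∀ (W : WeierstrassCurve ℚ) [W.IsElliptic] [W.IsGloballyMinimal] (p : ℕ) [Fact p.Prime],
      W.analyticRank = 1 → p ≠ 2 → ClassX3 W p → Additive.SubGordTwo W p →
        AdditiveStepLInputManinAt W p := by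
  intro W _ _ p _ hr hp2 hX hG N _ K _ _ Dt H ι P hr' hloc hN hK hodd hunit hHe hL hP hnt
  have hfin : (W.baseChange K).ShaFinite := (hKo N W K hK hHe ⟨Dt, H, ι, hP⟩ hnt).2
  have hS : Additive.SubSemistableTwist W p := Or.inr hG
  refine indexLowerBoundLeAt_of_frames_of_shaFinite hloc hN hK hHe hfin ?_ ?_
  · intro κ hκ γ _ 𝔭 h𝔭 he hf
    exact h3 W p hr hp2 hX hG N K Dt H ι P hr' hloc hN hK hodd hunit hHe hL hP hnt κ hκ γ 𝔭 h𝔭 he hf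
  · intro κ hκ γ _ 𝔭 h𝔭 he hf
    exact h4 W p hr hp2 hX hS N K Dt H ι P hr' hloc hN hK hodd hunit hHe hL hP hnt κ hκ γ 𝔭 h𝔭 he hf

/-- **`GordTwoBranchIMC` (BY NAME) ⇐ Kolyvagin + crux r4 + the (G-ord, `e = 2`) half of the TARGET.**
If STEP L, Manin-robust (`AdditiveStepLInputManinAt W p`, the target `StepLManin`'s socket) holds for
every pair on the potentially good ordinary `e = 2` reducible cell, then — Kolyvagin's finiteness of
`Ш(E/K)` turning the target's currency into the frames' currency
(`index_le_primary_of_indexLowerBoundLeAt_of_shaFinite`) and the control crux turning the frame-free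
inequality into the socket at every frame (`additiveIMCLowerBDPOnTreeLeAt_of_control_of_index_le`) —
the crux holds. The twin of door-c2's `potMultBranchIMC_of_kolyvagin_of_control_of_stepL_subM`.
CONDITIONAL on the three hypotheses. [cite: JetchevSkinnerWan2017, §7.4.1 (arXiv:1512.06894 p. 30)] [cite: Gross1991, Thm. 1.3] -/
theorem gordTwoBranchIMC_of_kolyvagin_of_control_of_stepL_subGordTwo
    (hKo : ∀ (N : ℕ) [NeZero N] (W : WeierstrassCurve ℚ) (K : Type) [Field K] [NumberField K],
      Literature.NumberTheory.EllipticCurves.kolyvagin N W K)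
    (h4 : Theses.SchneiderFreeAdditiveX3.AnticycControlAdditive)
    (hL : ∀ (W : WeierstrassCurve ℚ) [W.IsElliptic] [W.IsGloballyMinimal] (p : ℕ) [Fact p.Prime],
      W.analyticRank = 1 → p ≠ 2 → ClassX3 W p → Additive.SubGordTwo W p →
        AdditiveStepLInputManinAt W p) :
    Theses.SchneiderFreeAdditiveX3.GordTwoBranchIMC := by
  intro W _ _ p _ hr hp2 hX hG N _ K _ _ Dt H ι P hr' hloc hN hK hodd hunit hHe hLd hP hnt κ hκ γ _ 𝔭
    h𝔭 he hf
  have hS : Additive.SubSemistableTwist W p := Or.inr hG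
  have hfin : (W.baseChange K).ShaFinite := (hKo N W K hK hHe ⟨Dt, H, ι, hP⟩ hnt).2
  have hI : IndexLowerBoundLeAt W p K P (padicValNat p Dt.c.natAbs) :=
    hL W p hr hp2 hX hG N K Dt H ι P hr' hloc hN hK hodd hunit hHe hLd hP hnt
  exact additiveIMCLowerBDPOnTreeLeAt_of_control_of_index_le
    (h4 W p hr hp2 hX hS N K Dt H ι P hr' hloc hN hK hodd hunit hHe hLd hP hnt κ hκ γ 𝔭 h𝔭 he hf)
    (index_le_primary_of_indexLowerBoundLeAt_of_shaFinite hN hK hHe hfin hI)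

/-- **Modulo Kolyvagin and crux r4, crux r3 ⟺ the (G-ord, `e = 2`) half of the target** (in the
route's own predicates): `GordTwoBranchIMC ↔ ∀ pairs on (G-ord, e = 2), AdditiveStepLInputManinAt W p`.
So the decomposition of the door at (G-ord, `e = 2`) neither loses nor gains strength: the crux is
EXACTLY what the target needs there. CONDITIONAL on Kolyvagin (printed) and on crux r4 (open).
[cite: JetchevSkinnerWan2017, §7.4.1 (arXiv:1512.06894 p. 30)] -/
theorem gordTwoBranchIMC_iff_stepL_subGordTwo_of_kolyvagin_of_control
    (hKo : ∀ (N : ℕ) [NeZero N] (W : WeierstrassCurve ℚ) (K : Type) [Field K] [NumberField K],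
      Literature.NumberTheory.EllipticCurves.kolyvagin N W K)
    (h4 : Theses.SchneiderFreeAdditiveX3.AnticycControlAdditive) :
    Theses.SchneiderFreeAdditiveX3.GordTwoBranchIMC ↔
      ∀ (W : WeierstrassCurve ℚ) [W.IsElliptic] [W.IsGloballyMinimal] (p : ℕ) [Fact p.Prime],
        W.analyticRank = 1 → p ≠ 2 → ClassX3 W p → Additive.SubGordTwo W p →
          AdditiveStepLInputManinAt W p :=
  ⟨fun h3 ↦ additiveStepLInputManinAt_of_kolyvagin_of_gordTwo_of_control hKo h3 h4,
    fun hL ↦ gordTwoBranchIMC_of_kolyvagin_of_control_of_stepL_subGordTwo hKo h4 hL⟩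

/-! ### The door: modulo Kolyvagin and crux r4, the TARGET ⟺ the two branch cruxes -/

/-- **Modulo Kolyvagin and crux r4, the target `StepLManin` ⟺ `PotMultBranchIMC ∧ GordTwoBranchIMC`.**
Forward: the target restricted to `SubM` resp. `SubGordTwo` (`SubSemistableTwist = SubM ∪ SubGordTwo`)
gives each crux by the two converses (door-c2's `potMultBranchIMC_of_kolyvagin_of_control_of_stepL_subM`,
`gordTwoBranchIMC_of_kolyvagin_of_control_of_stepL_subGordTwo`); backward: door-c2 g0's
`stepLManin_of_kolyvagin_of_cruxes`. In kernel form: the route's two analytic cruxes are jointly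
EXACTLY its target, neither stronger nor weaker (given the printed Kolyvagin theorem and the control
crux). CONDITIONAL on Kolyvagin (printed) and on crux r4 (open). [cite: JetchevSkinnerWan2017, §7.4.1 (arXiv:1512.06894 p. 30)] -/
theorem stepLManin_iff_potMult_and_gordTwo_of_kolyvagin_of_control
    (hKo : ∀ (N : ℕ) [NeZero N] (W : WeierstrassCurve ℚ) (K : Type) [Field K] [NumberField K],
      Literature.NumberTheory.EllipticCurves.kolyvagin N W K)
    (h4 : Theses.SchneiderFreeAdditiveX3.AnticycControlAdditive) :
    Theses.SchneiderFreeAdditiveX3.StepLManin ↔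
      (Theses.SchneiderFreeAdditiveX3.PotMultBranchIMC ∧
        Theses.SchneiderFreeAdditiveX3.GordTwoBranchIMC) := by
  constructor
  · intro hL
    refine ⟨potMultBranchIMC_of_kolyvagin_of_control_of_stepL_subM hKo h4 ?_,
      gordTwoBranchIMC_of_kolyvagin_of_control_of_stepL_subGordTwo hKo h4 ?_⟩
    · intro W _ _ p _ hr hp2 hX hM
      exact hL W p hr hp2 hX (Or.inl hM)
    · intro W _ _ p _ hr hp2 hX hG
      exact hL W p hr hp2 hX (Or.inr hG)
  · rintro ⟨h2, h3⟩
    exact stepLManin_of_kolyvagin_of_cruxes hKo h2 h3 h4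

/-! ### rev-6 currency: the repaired control crux `AnticycControlAdditiveK` (item 19295) -/

/-- `GordTwoBranchIMC ↔` the (G-ord, `e = 2`) half of the target, modulo Kolyvagin and the repaired
control crux `AnticycControlAdditiveK` (= Kolyvagin → crux r4, item 19295). [cite: JetchevSkinnerWan2017, §7.4.1 (arXiv:1512.06894 p. 30)] -/
theorem gordTwoBranchIMC_iff_stepL_subGordTwo_of_kolyvagin_of_controlK
    (hKo : ∀ (N : ℕ) [NeZero N] (W : WeierstrassCurve ℚ) (K : Type) [Field K] [NumberField K],
      Literature.NumberTheory.EllipticCurves.kolyvagin N W K)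
    (h4 : Theses.SchneiderFreeAdditiveX3.AnticycControlAdditiveK) :
    Theses.SchneiderFreeAdditiveX3.GordTwoBranchIMC ↔
      ∀ (W : WeierstrassCurve ℚ) [W.IsElliptic] [W.IsGloballyMinimal] (p : ℕ) [Fact p.Prime],
        W.analyticRank = 1 → p ≠ 2 → ClassX3 W p → Additive.SubGordTwo W p →
          AdditiveStepLInputManinAt W p :=
  gordTwoBranchIMC_iff_stepL_subGordTwo_of_kolyvagin_of_control hKo (h4 hKo)

/-- The target `StepLManin ↔ PotMultBranchIMC ∧ GordTwoBranchIMC`, modulo Kolyvagin and the repaired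
control crux `AnticycControlAdditiveK` (item 19295) — the rev-6 form of
`stepLManin_iff_potMult_and_gordTwo_of_kolyvagin_of_control`. [cite: JetchevSkinnerWan2017, §7.4.1 (arXiv:1512.06894 p. 30)] -/
theorem stepLManin_iff_potMult_and_gordTwo_of_kolyvagin_of_controlK
    (hKo : ∀ (N : ℕ) [NeZero N] (W : WeierstrassCurve ℚ) (K : Type) [Field K] [NumberField K],
      Literature.NumberTheory.EllipticCurves.kolyvagin N W K)
    (h4 : Theses.SchneiderFreeAdditiveX3.AnticycControlAdditiveK) :
    Theses.SchneiderFreeAdditiveX3.StepLManin ↔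
      (Theses.SchneiderFreeAdditiveX3.PotMultBranchIMC ∧
        Theses.SchneiderFreeAdditiveX3.GordTwoBranchIMC) :=
  stepLManin_iff_potMult_and_gordTwo_of_kolyvagin_of_control hKo (h4 hKo)

end Summit.BirchSwinnertonDyer.BirchSwinnertonDyer.Theorems.SchneiderFree

end
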